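import Summits.CriticalPhenomena.SAWScalingLimit.Theorems.SAWTotalPositivityBoundaryTP2StripCertBox
import HarnessLib

/-!
# Crux `BoundaryTP2` (stmt-CriticalPhenomena-7115), line `Sketch`: `StripCert` part 3 — exact iteration,
base checks, the second compound (`Λ²T`, Cauchy–Binet), rate constraints (kernel-decidable)

Part 3 of the lead's all-length certificate kit: exact polynomial iterates `iterMV` of a data vector under a
data matrix and their agreement with real trajectories (`traj_eq_evV_iterMV`), uniform box membership of a
polynomial vector (`boxMemCheck`), wedge (second-compound) coordinates of two trajectories and the fact that
they are driven by `Λ²T` (`lambda2`, `wedgeR_mulTV`, `wedge_traj` — Cauchy–Binet for `2 × 2` minors), the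
base test `baseWedgeCheck`, and rate-constraint rows (`upRateCons`, `selfLoRateCons`, `selfUpRateCons`) to be
fed to `consCheck`.  Everything is proved. [folklore]
-/

namespace Summit.CriticalPhenomena.SAWScalingLimit.Theorems.BoundaryTP2.StripCert

open Summit.CriticalPhenomena.SAWScalingLimit.Theorems.BoundaryTP2.Negative.Cert

/-! ## §6 Exact iteration of polynomial vectors (base checks) and second-compound coordinates -/

/-- Real semantics of a vector of integer polynomials. [folklore] -/
noncomputable def evV (v : List (List ℤ)) (x : ℝ) : ℕ → ℝ := fun i => evZ (v.getD i []) x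

/-- Sum of a list of integer polynomials. [folklore] -/
def sumZ : List (List ℤ) → List ℤ
  | [] => []
  | p :: ps => addZ p (sumZ ps)

/-- `sumZ` sums. [folklore] -/
theorem evZ_sumZ (x : ℝ) : ∀ ps : List (List ℤ), evZ (sumZ ps) x = (ps.map fun p => evZ p x).sum
  | [] => by simp [sumZ]
  | p :: ps => by rw [sumZ, evZ_addZ, evZ_sumZ x ps, List.map_cons, List.sum_cons]

/-- Sum over a mapped `range` as a `Finset` sum. [folklore] -/
theorem sum_map_range (f : ℕ → ℝ) : ∀ k : ℕ, ((List.range k).map f).sum = ∑ j ∈ Finset.range k, f j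
  | 0 => by simp
  | k + 1 => by rw [List.range_succ, List.map_append, List.sum_append, sum_map_range f k,
      Finset.sum_range_succ]; simp

/-- Polynomial matrix times polynomial vector (first `k` rows and columns). [folklore] -/
def mulMV (T : List (List (List ℤ))) (k : ℕ) (v : List (List ℤ)) : List (List ℤ) :=
  (List.range k).map fun i => sumZ ((List.range k).map fun j => mulZ (ent T i j) (v.getD j []))

/-- **Semantics of `mulMV`** on the first `k` coordinates. [folklore] -/
theorem evV_mulMV (T : List (List (List ℤ))) (k : ℕ) (v : List (List ℤ)) (x : ℝ) {i : ℕ} (hi : i < k) :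
    evV (mulMV T k v) x i = mulTV T k x (evV v x) i := by
  simp only [evV, mulMV]
  have hrow : ∀ (f : ℕ → List ℤ), ((List.range k).map f).getD i [] = f i := fun f => by
    rw [List.getD_eq_getElem _ _ (by simpa using hi)]; simp
  rw [hrow, evZ_sumZ, List.map_map, mulTV]
  rw [show ((fun p => evZ p x) ∘ fun j => mulZ (ent T i j) (v.getD j [])) =
      fun j => evZ (ent T i j) x * evZ (v.getD j []) x from funext fun j => by simp [evZ_mulZ]]
  exact sum_map_range _ k

/-- Iterated `mulMV`. [folklore] -/
def iterMV (T : List (List (List ℤ))) (k : ℕ) : ℕ → List (List ℤ) → List (List ℤ)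
  | 0, v => v
  | t + 1, v => mulMV T k (iterMV T k t v)

/-- **Exact iteration**: a real trajectory driven by `T(x)` from `evV v₀ x` agrees on the first `k`
coordinates with the evaluated exact iterates. [folklore] -/
theorem traj_eq_evV_iterMV (T : List (List (List ℤ))) (k : ℕ) (x : ℝ) (v₀ : List (List ℤ))
    {z : ℕ → ℕ → ℝ} (h0 : ∀ i, i < k → z 0 i = evV v₀ x i)
    (hrec : ∀ t i, i < k → z (t + 1) i = mulTV T k x (z t) i) :
    ∀ (t i : ℕ), i < k → z t i = evV (iterMV T k t v₀) x i
  | 0, i, hi => h0 i hi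
  | t + 1, i, hi => by
    rw [hrec t i hi, iterMV, evV_mulMV T k _ x hi]
    exact (mulTV_congr T k x (fun j hj => (traj_eq_evV_iterMV T k x v₀ h0 hrec t j hj).symm) i).symm

/-- **Box membership test for a polynomial vector**, uniformly on the interval. [folklore] -/
def boxMemCheck (v : List (List ℤ)) (k : ℕ) (L H : List ℤ) (Dn : ℕ) (a m : ℤ) (D N : ℕ) : Bool :=
  posOn a m D N (v.getD 0 []) &&
    (List.range k).all fun i =>
      posOn a m D N (addZ (smulZ Dn (v.getD i [])) (smulZ (-(L.getD i 0)) (v.getD 0 []))) &&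
        posOn a m D N (addZ (smulZ (H.getD i 0) (v.getD 0 [])) (smulZ (-(Dn : ℤ)) (v.getD i [])))

/-- **Soundness of `boxMemCheck`**. [folklore] -/
theorem inBox_evV_of_boxMemCheck {v : List (List ℤ)} {k : ℕ} {L H : List ℤ} {Dn : ℕ} {a m : ℤ} {D N : ℕ}
    (h : boxMemCheck v k L H Dn a m D N = true) (hD : 0 < D) (hm : 0 < m) (hN : 0 < N) {x : ℝ}
    (h1 : (a : ℝ) / D ≤ x) (h2 : x ≤ ((a : ℝ) + m) / D) : InBox L H Dn k (evV v x) := by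
  simp only [boxMemCheck, Bool.and_eq_true, List.all_eq_true] at h
  obtain ⟨h0, hi⟩ := h
  refine ⟨evZ_nonneg_of_posOn hD hm hN h0 h1 h2, fun i hik => ⟨?_, ?_⟩⟩
  · have := evZ_nonneg_of_posOn hD hm hN (hi i (List.mem_range.2 hik)).1 h1 h2
    rw [evZ_addZ, evZ_smulZ, evZ_smulZ] at this
    simp only [evV]; push_cast at this; linarith
  · have := evZ_nonneg_of_posOn hD hm hN (hi i (List.mem_range.2 hik)).2 h1 h2
    rw [evZ_addZ, evZ_smulZ, evZ_smulZ] at this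
    simp only [evV]; push_cast at this; linarith

/-- The index pairs `(i,j)`, `i < j < k`, in lexicographic order. [folklore] -/
def pairs (k : ℕ) : List (ℕ × ℕ) :=
  ((List.range k).map fun i => ((List.range k).filter fun j => i < j).map fun j => (i, j)).flatten

/-- Second-compound (wedge) coordinates of two real vectors: `u_i w_j - u_j w_i` over `pairs k`. [folklore] -/
noncomputable def wedgeR (k : ℕ) (u w : ℕ → ℝ) : ℕ → ℝ :=
  fun p => u ((pairs k).getD p (0, 0)).1 * w ((pairs k).getD p (0, 0)).2 -
    u ((pairs k).getD p (0, 0)).2 * w ((pairs k).getD p (0, 0)).1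

/-- Wedge of two polynomial vectors. [folklore] -/
def wedgeV (k : ℕ) (u w : List (List ℤ)) : List (List ℤ) :=
  (pairs k).map fun ij => addZ (mulZ (u.getD ij.1 []) (w.getD ij.2 [])) (smulZ (-1) (mulZ (u.getD ij.2 []) (w.getD ij.1 [])))

/-- **Semantics of `wedgeV`**. [folklore] -/
theorem evV_wedgeV (k : ℕ) (u w : List (List ℤ)) (x : ℝ) {p : ℕ} (hp : p < (pairs k).length) :
    evV (wedgeV k u w) x p = wedgeR k (evV u x) (evV w x) p := by
  simp only [evV, wedgeV, wedgeR]
  rw [List.getD_eq_getElem _ _ (by simpa using hp), List.getElem_map, List.getD_eq_getElem _ _ hp,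
    evZ_addZ, evZ_mulZ, evZ_smulZ, evZ_mulZ]
  push_cast; ring

/-- `wedgeR` only reads coordinates below `k`. [folklore] -/
theorem wedgeR_congr (k : ℕ) {u u' w w' : ℕ → ℝ} (hu : ∀ i, i < k → u' i = u i) (hw : ∀ i, i < k → w' i = w i)
    (p : ℕ) : wedgeR k u' w' p = wedgeR k u w p := by
  have hmem : ∀ ij ∈ pairs k, ij.1 < k ∧ ij.2 < k := by
    intro ij hij
    simp only [pairs, List.mem_flatten, List.mem_map, List.mem_range] at hij
    obtain ⟨l, ⟨i, hi, rfl⟩, hij⟩ := hij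
    simp only [List.mem_map, List.mem_filter, List.mem_range] at hij
    obtain ⟨j, ⟨hj, _⟩, rfl⟩ := hij
    exact ⟨hi, hj⟩
  simp only [wedgeR]
  by_cases hp : p < (pairs k).length
  · obtain ⟨h1, h2⟩ := hmem _ (List.getD_eq_getElem (pairs k) (0, 0) hp ▸ List.getElem_mem hp)
    rw [hu _ h1, hu _ h2, hw _ h1, hw _ h2]
  · rw [List.getD_eq_default _ _ (not_lt.1 hp)]
    by_cases hk : 0 < k
    · rw [hu 0 hk, hw 0 hk]
    · simp only [not_lt, Nat.le_zero] at hk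
      subst hk
      simp

/-- **Base test for second-compound trajectories**: the wedge of the exact iterates at time `n₀` is in the box. [folklore] -/
def baseWedgeCheck (T : List (List (List ℤ))) (k : ℕ) (u₀ w₀ : List (List ℤ)) (n₀ : ℕ) (L H : List ℤ)
    (Dn : ℕ) (a m : ℤ) (D N : ℕ) : Bool :=
  boxMemCheck (wedgeV k (iterMV T k n₀ u₀) (iterMV T k n₀ w₀)) (pairs k).length L H Dn a m D N

/-- **Soundness of the base test**: for real trajectories `u, w` driven by `T(x)` from `evV u₀ x`, `evV w₀ x`,
the wedge coordinates at time `n₀` are in the box. [folklore] -/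
theorem inBox_wedge_of_baseWedgeCheck {T : List (List (List ℤ))} {k : ℕ} {u₀ w₀ : List (List ℤ)} {n₀ : ℕ}
    {L H : List ℤ} {Dn : ℕ} {a m : ℤ} {D N : ℕ} (h : baseWedgeCheck T k u₀ w₀ n₀ L H Dn a m D N = true)
    (hD : 0 < D) (hm : 0 < m) (hN : 0 < N) {x : ℝ} (h1 : (a : ℝ) / D ≤ x) (h2 : x ≤ ((a : ℝ) + m) / D)
    {u w : ℕ → ℕ → ℝ} (hu0 : ∀ i, i < k → u 0 i = evV u₀ x i) (hw0 : ∀ i, i < k → w 0 i = evV w₀ x i)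
    (hu : ∀ t i, i < k → u (t + 1) i = mulTV T k x (u t) i) (hw : ∀ t i, i < k → w (t + 1) i = mulTV T k x (w t) i)
    (hk : 0 < (pairs k).length) :
    InBox L H Dn (pairs k).length (wedgeR k (u n₀) (w n₀)) := by
  have hb := inBox_evV_of_boxMemCheck h hD hm hN h1 h2
  have hU := traj_eq_evV_iterMV T k x u₀ hu0 hu n₀
  have hW := traj_eq_evV_iterMV T k x w₀ hw0 hw n₀
  have key : ∀ p, p < (pairs k).length →
      wedgeR k (u n₀) (w n₀) p = evV (wedgeV k (iterMV T k n₀ u₀) (iterMV T k n₀ w₀)) x p := by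
    intro p hp
    rw [evV_wedgeV k _ _ x hp]
    exact wedgeR_congr k hU hW p
  exact hb.congr (key 0 hk) key


/-! ## §7 The second compound: minors of two trajectories follow `Λ²T` -/

/-- The second-compound matrix `Λ²T` on the index pairs `pairs k` (as data). [folklore] -/
def lambda2 (T : List (List (List ℤ))) (k : ℕ) : List (List (List ℤ)) :=
  (pairs k).map fun ij => (pairs k).map fun ab =>
    addZ (mulZ (ent T ij.1 ab.1) (ent T ij.2 ab.2)) (smulZ (-1) (mulZ (ent T ij.1 ab.2) (ent T ij.2 ab.1)))

/-- A `Finset` sum over list indices is the mapped list sum. [folklore] -/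
theorem sum_range_getD {α : Type*} (F : α → ℝ) (d : α) :
    ∀ l : List α, ∑ q ∈ Finset.range l.length, F (l.getD q d) = (l.map F).sum
  | [] => by simp
  | y :: ys => by
    rw [List.length_cons, Finset.sum_range_succ', List.map_cons, List.sum_cons, ← sum_range_getD F d ys]
    simp [add_comm]

/-- Filtered list sums as `ite` sums. [folklore] -/
theorem sum_map_filter_range (p : ℕ → Prop) [DecidablePred p] (f : ℕ → ℝ) : ∀ k : ℕ,
    (((List.range k).filter fun b => p b).map f).sum = ∑ b ∈ Finset.range k, if p b then f b else 0
  | 0 => by simp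
  | k + 1 => by
    rw [List.range_succ, List.filter_append, List.map_append, List.sum_append, sum_map_filter_range p f k,
      Finset.sum_range_succ]
    by_cases hk : p k
    · simp [hk]
    · simp [hk]

/-- The list `pairs k` sums like the triangle `a < b < k`. [folklore] -/
theorem sum_map_pairs (h : ℕ × ℕ → ℝ) (k : ℕ) :
    ((pairs k).map h).sum = ∑ a ∈ Finset.range k, ∑ b ∈ Finset.range k, if a < b then h (a, b) else 0 := by
  rw [pairs, List.map_flatten, List.sum_flatten, List.map_map, List.map_map]
  rw [show ((List.sum ∘ List.map h) ∘ fun i => ((List.range k).filter fun j => i < j).map fun j => (i, j)) =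
      fun a => ∑ b ∈ Finset.range k, if a < b then h (a, b) else 0 from ?_]
  · exact sum_map_range _ k
  funext a
  simp only [Function.comp_apply, List.map_map]
  have := sum_map_filter_range (fun b => a < b) (fun b => h (a, b)) k
  simpa [Function.comp_def] using this

/-- Triangle decomposition of a double sum over a square. [folklore] -/
theorem sum_sum_eq_triangle (g : ℕ → ℕ → ℝ) (k : ℕ) :
    ∑ a ∈ Finset.range k, ∑ b ∈ Finset.range k, g a b =
      ∑ a ∈ Finset.range k, ∑ b ∈ Finset.range k, (if a < b then g a b + g b a else 0) +
        ∑ a ∈ Finset.range k, g a a := by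
  have split : ∀ a b : ℕ, g a b =
      (if a < b then g a b else 0) + (if a = b then g a b else 0) + (if b < a then g a b else 0) := by
    intro a b
    rcases lt_trichotomy a b with hab | rfl | hab
    · simp [hab, hab.ne, not_lt.2 hab.le]
    · simp
    · simp [hab, hab.ne', not_lt.2 hab.le]
  have h3 : ∑ a ∈ Finset.range k, ∑ b ∈ Finset.range k, (if b < a then g a b else 0) =
      ∑ a ∈ Finset.range k, ∑ b ∈ Finset.range k, (if a < b then g b a else 0) := by
    rw [Finset.sum_comm]
  have h2 : ∑ a ∈ Finset.range k, ∑ b ∈ Finset.range k, (if a = b then g a b else 0) =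
      ∑ a ∈ Finset.range k, g a a := by
    refine Finset.sum_congr rfl fun a ha => ?_
    rw [Finset.sum_ite_eq]; simp [ha]
  calc ∑ a ∈ Finset.range k, ∑ b ∈ Finset.range k, g a b
      = ∑ a ∈ Finset.range k, ∑ b ∈ Finset.range k,
          ((if a < b then g a b else 0) + (if a = b then g a b else 0) + (if b < a then g a b else 0)) := by
        refine Finset.sum_congr rfl fun a _ => Finset.sum_congr rfl fun b _ => split a b
    _ = ∑ a ∈ Finset.range k, ∑ b ∈ Finset.range k, (if a < b then g a b else 0) +
          ∑ a ∈ Finset.range k, ∑ b ∈ Finset.range k, (if a = b then g a b else 0) +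
          ∑ a ∈ Finset.range k, ∑ b ∈ Finset.range k, (if b < a then g a b else 0) := by
        simp only [Finset.sum_add_distrib]
    _ = _ := by
        rw [h2, h3, add_right_comm, ← Finset.sum_add_distrib]
        congr 1
        refine Finset.sum_congr rfl fun a _ => ?_
        rw [← Finset.sum_add_distrib]
        refine Finset.sum_congr rfl fun b _ => ?_
        split_ifs <;> ring

/-- **Cauchy–Binet for `2 × 2` minors**: the wedge coordinates of `T u, T w` are `Λ²T` applied to those of
`u, w`. [folklore] -/
theorem wedgeR_mulTV (T : List (List (List ℤ))) (k : ℕ) (x : ℝ) (u w : ℕ → ℝ) {p : ℕ}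
    (hp : p < (pairs k).length) :
    wedgeR k (mulTV T k x u) (mulTV T k x w) p =
      mulTV (lambda2 T k) (pairs k).length x (wedgeR k u w) p := by
  set i := ((pairs k).getD p (0, 0)).1 with hi
  set j := ((pairs k).getD p (0, 0)).2 with hj
  -- the entries as functions of the pair
  set F : ℕ × ℕ → List ℤ := fun ab =>
    addZ (mulZ (ent T i ab.1) (ent T j ab.2)) (smulZ (-1) (mulZ (ent T i ab.2) (ent T j ab.1))) with hF
  have hrow : (lambda2 T k).getD p [] = (pairs k).map F := by
    rw [lambda2, List.getD_eq_getElem _ _ (by simpa using hp), List.getElem_map, hF, hi, hj,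
      List.getD_eq_getElem _ _ hp]
  have hent : ∀ q, q < (pairs k).length → ent (lambda2 T k) p q = F ((pairs k).getD q (0, 0)) := by
    intro q hq
    rw [ent, hrow, List.getD_eq_getElem _ _ (by simpa using hq), List.getElem_map, List.getD_eq_getElem _ _ hq]
  have hFev : ∀ ab : ℕ × ℕ, evZ (F ab) x =
      evZ (ent T i ab.1) x * evZ (ent T j ab.2) x - evZ (ent T i ab.2) x * evZ (ent T j ab.1) x := by
    intro ab; rw [hF]; simp only; rw [evZ_addZ, evZ_mulZ, evZ_smulZ, evZ_mulZ]; push_cast; ring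
  -- right-hand side as a triangle sum
  set Φ : ℕ × ℕ → ℝ := fun ab => evZ (F ab) x * (u ab.1 * w ab.2 - u ab.2 * w ab.1) with hΦ
  have rhs : mulTV (lambda2 T k) (pairs k).length x (wedgeR k u w) p =
      ∑ a ∈ Finset.range k, ∑ b ∈ Finset.range k, if a < b then Φ (a, b) else 0 := by
    rw [mulTV, ← sum_map_pairs Φ k, ← sum_range_getD Φ (0, 0) (pairs k)]
    refine Finset.sum_congr rfl fun q hq => ?_
    rw [hent q (Finset.mem_range.1 hq), hΦ, wedgeR]
  -- left-hand side as a double sum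
  have lhs : wedgeR k (mulTV T k x u) (mulTV T k x w) p =
      ∑ a ∈ Finset.range k, ∑ b ∈ Finset.range k,
        (evZ (ent T i a) x * evZ (ent T j b) x - evZ (ent T j a) x * evZ (ent T i b) x) * (u a * w b) := by
    have e1 : wedgeR k (mulTV T k x u) (mulTV T k x w) p =
        mulTV T k x u i * mulTV T k x w j - mulTV T k x u j * mulTV T k x w i := by
      rw [wedgeR]
    rw [e1]
    simp only [mulTV]
    rw [Finset.sum_mul_sum, Finset.sum_mul_sum, ← Finset.sum_sub_distrib]
    refine Finset.sum_congr rfl fun a _ => ?_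
    rw [← Finset.sum_sub_distrib]
    refine Finset.sum_congr rfl fun b _ => ?_
    ring
  rw [lhs, rhs, sum_sum_eq_triangle]
  have hdiag : ∑ a ∈ Finset.range k,
      (evZ (ent T i a) x * evZ (ent T j a) x - evZ (ent T j a) x * evZ (ent T i a) x) * (u a * w a) = 0 :=
    Finset.sum_eq_zero fun a _ => by ring
  rw [hdiag, add_zero]
  refine Finset.sum_congr rfl fun a _ => Finset.sum_congr rfl fun b _ => ?_
  split_ifs
  · rw [hΦ]; simp only; rw [hFev]; ring
  · rfl

/-- **Second-compound trajectories**: if `u, w` are driven by `T(x)` on the first `k` coordinates then their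
wedge coordinates are driven by `Λ²T(x)`. [folklore] -/
theorem wedge_traj (T : List (List (List ℤ))) (k : ℕ) (x : ℝ) {u w : ℕ → ℕ → ℝ}
    (hu : ∀ t i, i < k → u (t + 1) i = mulTV T k x (u t) i) (hw : ∀ t i, i < k → w (t + 1) i = mulTV T k x (w t) i)
    (t p : ℕ) (hp : p < (pairs k).length) :
    wedgeR k (u (t + 1)) (w (t + 1)) p = mulTV (lambda2 T k) (pairs k).length x (wedgeR k (u t) (w t)) p := by
  rw [← wedgeR_mulTV T k x (u t) (w t) hp]
  exact wedgeR_congr k (hu t) (hw t) p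


/-! ## §8 Rate-constraint rows -/

/-- Constraint polynomials of an UPPER RATE for coordinate `i` relative to the anchor:
`R(x) · z 0 - E · (T(x) z)_i ≥ 0`. [folklore] -/
def upRateCons (T : List (List (List ℤ))) (k : ℕ) (E : ℤ) (R : List ℤ) (i : ℕ) : List (List ℤ) :=
  (List.range k).map fun j => addZ (if j = 0 then R else []) (smulZ (-E) (ent T i j))

/-- Semantics of `upRateCons`. [folklore] -/
theorem dotV_upRateCons (T : List (List (List ℤ))) {k : ℕ} (hk : 0 < k) (E : ℤ) (R : List ℤ) (i : ℕ)
    (x : ℝ) (z : ℕ → ℝ) :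
    dotV (upRateCons T k E R i) x z 0 = evZ R x * z 0 - (E : ℝ) * mulTV T k x z i := by
  rw [upRateCons, dotV_map_range, mulTV, Finset.mul_sum]
  have : ∀ j ∈ Finset.range k, evZ (addZ (if j = 0 then R else []) (smulZ (-E) (ent T i j))) x * z j =
      (if j = 0 then evZ R x * z j else 0) - (E : ℝ) * (evZ (ent T i j) x * z j) := by
    intro j _
    rw [evZ_addZ, evZ_smulZ]
    split_ifs <;> push_cast <;> simp <;> ring
  rw [Finset.sum_congr rfl this, Finset.sum_sub_distrib, Finset.sum_ite_eq' (Finset.range k) 0]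
  simp [hk]

/-- Constraint polynomials of a LOWER RATE for coordinate `i` relative to itself:
`E · (T(x) z)_i - S(x) · z i ≥ 0`. [folklore] -/
def selfLoRateCons (T : List (List (List ℤ))) (k : ℕ) (E : ℤ) (S : List ℤ) (i : ℕ) : List (List ℤ) :=
  (List.range k).map fun j => addZ (smulZ E (ent T i j)) (if j = i then smulZ (-1) S else [])

/-- Semantics of `selfLoRateCons`. [folklore] -/
theorem dotV_selfLoRateCons (T : List (List (List ℤ))) {k i : ℕ} (hi : i < k) (E : ℤ) (S : List ℤ)
    (x : ℝ) (z : ℕ → ℝ) :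
    dotV (selfLoRateCons T k E S i) x z 0 = (E : ℝ) * mulTV T k x z i - evZ S x * z i := by
  rw [selfLoRateCons, dotV_map_range, mulTV, Finset.mul_sum]
  have : ∀ j ∈ Finset.range k, evZ (addZ (smulZ E (ent T i j)) (if j = i then smulZ (-1) S else [])) x * z j =
      (E : ℝ) * (evZ (ent T i j) x * z j) - (if j = i then evZ S x * z j else 0) := by
    intro j _
    rw [evZ_addZ, evZ_smulZ]
    split_ifs <;> simp [evZ_smulZ] <;> ring
  rw [Finset.sum_congr rfl this, Finset.sum_sub_distrib, Finset.sum_ite_eq' (Finset.range k) i]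
  simp [hi]

/-- Constraint polynomials of an UPPER RATE for coordinate `i` relative to itself:
`S(x) · z i - E · (T(x) z)_i ≥ 0`. [folklore] -/
def selfUpRateCons (T : List (List (List ℤ))) (k : ℕ) (E : ℤ) (S : List ℤ) (i : ℕ) : List (List ℤ) :=
  (List.range k).map fun j => addZ (if j = i then S else []) (smulZ (-E) (ent T i j))

/-- Semantics of `selfUpRateCons`. [folklore] -/
theorem dotV_selfUpRateCons (T : List (List (List ℤ))) {k i : ℕ} (hi : i < k) (E : ℤ) (S : List ℤ)
    (x : ℝ) (z : ℕ → ℝ) :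
    dotV (selfUpRateCons T k E S i) x z 0 = evZ S x * z i - (E : ℝ) * mulTV T k x z i := by
  rw [selfUpRateCons, dotV_map_range, mulTV, Finset.mul_sum]
  have : ∀ j ∈ Finset.range k, evZ (addZ (if j = i then S else []) (smulZ (-E) (ent T i j))) x * z j =
      (if j = i then evZ S x * z j else 0) - (E : ℝ) * (evZ (ent T i j) x * z j) := by
    intro j _
    rw [evZ_addZ, evZ_smulZ]
    split_ifs <;> push_cast <;> simp <;> ring
  rw [Finset.sum_congr rfl this, Finset.sum_sub_distrib, Finset.sum_ite_eq' (Finset.range k) i]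
  simp [hi]

end Summit.CriticalPhenomena.SAWScalingLimit.Theorems.BoundaryTP2.StripCert
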